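import Summits.AtomisticToContinuum.Crystallization.Theorems.SquareWellLayerCakeGapTwelveToBarlowCombinatorialLayeringReach

/-!
# Combinatorial layering (B1a of `GapTwelveToBarlow`): reachability from a covered interior point

Crux `SquareWellLayerCake.GapTwelveToBarlow` (stmt-AtomisticToContinuum-15807), line `Sketch`,
stub `stub_develop` (H_develop).  The relative form of `reach_of_walk`: if `Φ` develops the model
STAR-surjectively on the covered diamond and a bond walk of length `m` starts at the image of a
model point with `|k₀| ≤ m₀`, `|j₀| + |i₀| + 3|k₀| ≤ 4m₀`, then its endpoint is the image of a model
point with `|k| ≤ m₀ + m`, `|j| + |i| + 3|k| ≤ 4(m₀ + m)`, at model distance `≤ m` from the start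
(`reach_from`, anchor).  Used twice in the metric closure of `stub_develop`: from the base to the
centre `x i`, and from the centre to the sites of its `D`-ball.  `[folklore]`.
-/

noncomputable section

namespace Summit.AtomisticToContinuum.Crystallization.Theorems.SquareWellLayerCakeGapTwelveToBarlow

open Literature.Geometry.DiscreteGeometry Literature.MathematicalPhysics.StatisticalMechanics

/-- **Reachability from a covered point, with the model distance of the endpoint** (anchor of this
file). [folklore] -/
theorem reach_from :
    ∀ (N : ℕ) (x : Fin N → EuclideanSpace ℝ (Fin 3)) (s : ℤ → ℤ) (Φ : EuclideanSpace ℝ (Fin 3) →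
    Fin N) (K R m₀ : ℕ) (k₀ i₀ j₀ : ℤ), IsHaggSeq s → k₀.natAbs ≤ m₀ → j₀.natAbs + i₀.natAbs + 3 *
    k₀.natAbs ≤ 4 * m₀ → (∀ k i j : ℤ, k.natAbs + 1 ≤ K → j.natAbs + i.natAbs + 3 * (k.natAbs + 1)
    + 4 ≤ R → ∀ l : Fin N, l ≠ Φ (barlowPos 1 (Real.sqrt (2 / 3)) s k i j) → dist (x (Φ (barlowPos
    1 (Real.sqrt (2 / 3)) s k i j))) (x l) ≤ 1 → ∃ q ∈ barlowStacking 1 (Real.sqrt (2 / 3)) s, dist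
    (barlowPos 1 (Real.sqrt (2 / 3)) s k i j) q = 1 ∧ Φ q = l) → ∀ (m : ℕ) (c : ℕ → Fin N), c 0 = Φ
    (barlowPos 1 (Real.sqrt (2 / 3)) s k₀ i₀ j₀) → (∀ t : ℕ, t < m → c t = c (t + 1) ∨ dist (x (c
    t)) (x (c (t + 1))) ≤ 1) → m₀ + m + 2 ≤ K → 4 * (m₀ + m) + 7 ≤ R → ∃ k i j : ℤ, k.natAbs ≤ m₀ +
    m ∧ j.natAbs + i.natAbs + 3 * k.natAbs ≤ 4 * (m₀ + m) ∧ Φ (barlowPos 1 (Real.sqrt (2 / 3)) s k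
    i j) = c m ∧ dist (barlowPos 1 (Real.sqrt (2 / 3)) s k i j) (barlowPos 1 (Real.sqrt (2 / 3)) s
    k₀ i₀ j₀) ≤ m := by
  intro N x s Φ K R m₀ k₀ i₀ j₀ hs hk₀ hij₀ hstar m
  induction m with
  | zero =>
    intro c hc0 _ _ _
    exact ⟨k₀, i₀, j₀, by omega, by omega, hc0.symm, by simp⟩
  | succ m ih =>
    intro c hc0 hw hK hR
    obtain ⟨k, i, j, hk, hij, hΦ, hd⟩ := ih c hc0 (fun t ht => hw t (by omega)) (by omega) (by omega)
    rcases hw m (by omega) with he | hbond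
    · exact ⟨k, i, j, by omega, by omega, by rw [hΦ, he], hd.trans (by push_cast; linarith)⟩
    · by_cases heq : c (m + 1) = Φ (barlowPos 1 (Real.sqrt (2 / 3)) s k i j)
      · exact ⟨k, i, j, by omega, by omega, heq.symm, hd.trans (by push_cast; linarith)⟩
      · rw [← hΦ] at hbond
        obtain ⟨q, hqS, hqd, hqΦ⟩ := hstar k i j (by omega) (by omega) (c (m + 1)) heq hbond
        obtain ⟨r, P, Q, hr, hPQ, rfl⟩ := exists_contact_coords hs k i j hqS hqd
        refine ⟨k + r, i - P, j - Q, ?_, ?_, hqΦ, ?_⟩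
        · have := Int.natAbs_add_le k r; omega
        · have h1 := Int.natAbs_add_le k r
          have h2 := Int.natAbs_sub_le i P
          have h3 := Int.natAbs_sub_le j Q
          omega
        · calc dist (barlowPos 1 (Real.sqrt (2 / 3)) s (k + r) (i - P) (j - Q))
                (barlowPos 1 (Real.sqrt (2 / 3)) s k₀ i₀ j₀)
              ≤ dist (barlowPos 1 (Real.sqrt (2 / 3)) s (k + r) (i - P) (j - Q))
                  (barlowPos 1 (Real.sqrt (2 / 3)) s k i j) +
                dist (barlowPos 1 (Real.sqrt (2 / 3)) s k i j)
                  (barlowPos 1 (Real.sqrt (2 / 3)) s k₀ i₀ j₀) := dist_triangle _ _ _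
            _ ≤ 1 + m := by rw [dist_comm, hqd]; linarith
            _ = ((m + 1 : ℕ) : ℝ) := by push_cast; ring

end Summit.AtomisticToContinuum.Crystallization.Theorems.SquareWellLayerCakeGapTwelveToBarlow
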